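import Summits.QuantumFields.BalabanUV.Gaps.EndSurvivorExtension
import Summits.QuantumFields.BalabanUV.Gaps.EndContLetterWitness
import Summits.QuantumFields.BalabanUV.Gaps.EndFoliationHeadline

/-!
# Gaps / EndSurvivorThm2 — [I] THEOREM 2's PRINTED SHAPE (0.31) IN THE SURVIVOR PLACEMENT: two-sided bounds `0 < b ≤ trace ≤ β′` and continuity
# of the traces ON THE SURVIVOR SETS `S_k` give `B12.Thm2Printed C L` (two-sided Tietze in the bare coupling); NEGATIVE N-18 — a uniform POSITIVE
# lower bound does NOT make the continuity letter spare (the shifted staircase); and the datum form — a PORT into the tree, with attribution, of g1-plan-2 GEN 19's lens kernel `HOME/g1/skeletons/XreadHordFadingMemory_plan2.lean`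
# (v1.11, sha16 3364e01583b84190, §16 `Thm2Survivors` ∕ `Datum16`; lens items S-48 ∕ R-39, N-18; offered for porting in [G1-PLAN2-G19-S48];
# the §15 datum ∕ headline one-liners (S-47) ride in `Gaps/EndSurvivorCensus`)
# (cell pub-balaban-gaps, seat g1-p3 gen 7, row CAP+tail ∕ β-currency «split ∕ weakening»; file 9 of «the binder census of the END roads»; independent of `Gaps/EndSurvivorCensus`)

HONEST FRAMING (cell rule, page 1 of everything): [folklore] real analysis (Tietze–Urysohn on a closed subset of `]0,γ₀]`) + one TOY β-family over the
tree's typed carriers (`FlowStep.HBeta` ∕ `clampPrefix` ∕ `Y` ∕ `RGEqH` ∕ `solveCoupling` ∕ `genSeq`, `FlowStepRuns`, `DagBinding.EndpointExistence` ∕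
`modelOf`, `B12.Thm2Printed` — the coordinator's verbatim transcription of (0.31), p. 259 — as conclusion SHAPE, `T4ContinuumYM4Torus`).  AUTHORSHIP: the
mathematics and the Lean text of every declaration below are g1-plan-2 GEN 19's (planner seat; planners file nothing on the ledger by mandate —
«provers may port»); this seat's contribution is the port (namespace, imports, this header, references re-pointed to the tree's leaves; the kernel's
copies of `thm2Printed_of_runs` ∕ `endpointExistence_of_thm2Printed` and its re-derived foliation ∕ box corollaries are NOT repeated — the tree has
them in `Gaps/EndFoliationHeadline` and `FlowStepRuns`) and the kernel re-check against the tree.  `b > 0` uniformly for Bałaban's β is the located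
UNPRINTED input of rows CAP ∕ tail ([I] Thm 2 «will be given in a separate paper»; [II] p. 355 «has not been published yet»); continuity in the coupling
is ASSERTED in print ([I] §1 pp. 263–264): a REDUCTION of the hypothesis set of the Theorem-2 node, NOT a proof of Theorem 2; NO word of record moves.
NOTHING of Bałaban's is asserted; 0∕6 binders; 0 coefficients certified; one finite T⁴; NOT B12 Thm 2, NOT `BetaPertH`, NOT the continuum limit, NOT Clay.

THE POINT (g1-plan-2 S-48 ∕ R-39 and S-47, verbatim in substance).  `B12.Thm2Printed C L` is the END binder PLUS (0.31)
(`EndFoliationHeadline.endpointExistence_of_thm2Printed`).  The tree discharges it from BOX letters (`FlowStepRuns.thm2Printed_of_boxBoundsH` :211);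
`Gaps/EndFoliationHeadline` §2b moved the three letters to the one-parameter family of clamped prefixes; `Gaps/EndSurvivorExtension`'s machinery moves
them to where the proof READS them: **`thm2Printed_of_survivorBounds`** — forward-generated `C`, `1 < L`, `0 < γ₀`, `0 < b ≤ β′`, continuity of each
trace `x ↦ β_k(clampPrefix β γ₀ k x)` ON `S_k` and `b ≤ trace ≤ β′` ON `S_k` ⟹ `B12.Thm2Printed C L` (two-sided Tietze
**`exists_extension_of_survivorLetters_twoSided`** ⟹ `extH F` carries (C), `BetaLowerH b` (`betaLowerH_extH`), (U) on the boxes ⟹ :211 for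
`modelOf (extH F)` ⟹ transfer by `EndFoliationHeadline.thm2Printed_of_runs` through `EndSurvivorExtension.rgEqH_of_rgEqH_extH`); datum form
`thm2Printed_of_survivorBounds_datum`.  NEGATIVE N-18: the SHIFTED STAIRCASE `betaJc c := stair(g_k) + c` (`0 ≤ c ≤ 1`; `c ≤ β ≤ 1 + c` on every box)
has NO `EndpointExistence` (**`not_endpointExistence_betaJc`**: the punctures of N-15 shifted by `c`), hence no Theorem-2 shape at any `L`, so
**`thm2BoxBounds_false_without_hcont`** — :211 is FALSE with its continuity binder deleted EVEN WITH A UNIFORM POSITIVE LOWER BOUND — and a fortiori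
`thm2SurvivorBounds_false_without_hsc`; census **`thm2_survivor_census`** (R-39: «[I] Thm 2 as printed ⟸ along the in-interval runs of one level γ₀:
`0 < b ≤ β ≤ β′` + continuity of the survivor traces; asymptotic freedom with a uniform constant does not replace the continuity»).  §3: the datum form
`thm2Printed_of_survivorBounds_datum` (`D.fwd` a field).
0 sorry; TWO toy definitions (`betaJc`, `gJc`; no `def … : Prop`); imports `Gaps/EndSurvivorExtension` + `Gaps/EndContLetterWitness` (toy `stair` ∕ `uJ`)
+ `Gaps/EndFoliationHeadline` (→ `T4ContinuumYM4Torus`); restates nothing of the tree.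

CITATION HEADER (tags CONTEXT ONLY).  [I] = T. Bałaban, Commun. Math. Phys. **109** (1987) [Balaban1987RG1]: Thm 2 ∕ (0.31) p. 259, (0.20) p. 256,
§1 pp. 263–264; [II] = Commun. Math. Phys. **122** (1989) [Balaban1989LargeFieldII] p. 355.
-/

namespace Summit.QuantumFields.BalabanUV.Gaps.EndSurvivorThm2

open Literature.MathematicalPhysics.QuantumFieldTheory.Balaban1983to89
open Literature.MathematicalPhysics.QuantumFieldTheory.Balaban1983to89.FlowStep
open Literature.MathematicalPhysics.QuantumFieldTheory.Balaban1983to89.FlowStepRuns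
open Literature.MathematicalPhysics.QuantumFieldTheory.Balaban1983to89.DagBinding
open Literature.MathematicalPhysics.QuantumFieldTheory.Balaban1983to89.T4Continuum
open Literature.MathematicalPhysics.QuantumFieldTheory.Balaban1983to89.T4ContinuumYM4Torus
open Summit.QuantumFields.BalabanUV.Gaps.EndRunwiseShooting
open Summit.QuantumFields.BalabanUV.Gaps.EndTopRunCriterion
open Summit.QuantumFields.BalabanUV.Gaps.EndUpperPerLevel
open Summit.QuantumFields.BalabanUV.Gaps.EndContAlongFoliation
open Summit.QuantumFields.BalabanUV.Gaps.EndContLetterWitness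
open Summit.QuantumFields.BalabanUV.Gaps.EndFoliationHeadline
open Summit.QuantumFields.BalabanUV.Gaps.EndSurvivorExtension
open Topology Finset

universe u

noncomputable section

/-! ## §1 Two-sided Tietze in the bare coupling; Theorem 2's printed shape from the survivor letters (g1-plan-2 kernel §16, ported) -/

/-- (0.31)'s LOWER letter for the bare-coupling extension family from a lower bound of the table. [folklore] -/
theorem betaLowerH_extH {F : ℕ → ℝ → ℝ} {γ₀ b : ℝ} (hF : ∀ (k : ℕ) (x : ℝ), 0 < x → x ≤ γ₀ → b ≤ F k x) :
    BetaLowerH b γ₀ (extH F) :=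
  fun k v hv => hF k (v 0) ((mem_box.mp hv) 0).1 ((mem_box.mp hv) 0).2

/-- **TWO-SIDED TIETZE IN THE BARE COUPLING.**  If every trace `x ↦ β_k(clampPrefix β γ₀ k x)` is continuous on its survivor set `S_k` and
satisfies `b ≤ trace ≤ B_k` there (`b ≤ B_k`), there is a table `F` of functions CONTINUOUS ON ALL OF `]0,γ₀]` with the SAME two-sided bounds,
agreeing with the traces on the survivor sets (Tietze–Urysohn on the closed subset `S_k` of the normal space `]0,γ₀]`, target interval `[b, B_k]`;
`EndSurvivorExtension.exists_extension_of_survivorLetters` is the one-sided case). [folklore] -/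
theorem exists_extension_of_survivorLetters_twoSided {β : HBeta} {γ₀ b : ℝ} {B : ℕ → ℝ} (hbB : ∀ k : ℕ, b ≤ B k)
    (hsc : ∀ k : ℕ, ContinuousOn (fun x : ℝ => β k (clampPrefix β γ₀ k x))
      {x : ℝ | 0 < x ∧ x ≤ γ₀ ∧ ∀ j, j ≤ k → 1 / γ₀ ^ 2 ≤ Y β γ₀ j x})
    (hsl : ∀ (k : ℕ) (x : ℝ), 0 < x → x ≤ γ₀ → (∀ j, j ≤ k → 1 / γ₀ ^ 2 ≤ Y β γ₀ j x) →
      b ≤ β k (clampPrefix β γ₀ k x))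
    (hsu : ∀ (k : ℕ) (x : ℝ), 0 < x → x ≤ γ₀ → (∀ j, j ≤ k → 1 / γ₀ ^ 2 ≤ Y β γ₀ j x) →
      β k (clampPrefix β γ₀ k x) ≤ B k) :
    ∃ F : ℕ → ℝ → ℝ, (∀ k : ℕ, ContinuousOn (F k) (Set.Ioc 0 γ₀)) ∧
      (∀ (k : ℕ) (x : ℝ), 0 < x → x ≤ γ₀ → b ≤ F k x) ∧
      (∀ (k : ℕ) (x : ℝ), 0 < x → x ≤ γ₀ → F k x ≤ B k) ∧
      ∀ (k : ℕ) (x : ℝ), 0 < x → x ≤ γ₀ → (∀ j, j ≤ k → 1 / γ₀ ^ 2 ≤ Y β γ₀ j x) →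
        F k x = β k (clampPrefix β γ₀ k x) := by
  have key : ∀ k : ℕ, ∃ Fk : ℝ → ℝ, ContinuousOn Fk (Set.Ioc 0 γ₀) ∧ (∀ x : ℝ, 0 < x → x ≤ γ₀ → b ≤ Fk x) ∧
      (∀ x : ℝ, 0 < x → x ≤ γ₀ → Fk x ≤ B k) ∧
      ∀ x : ℝ, 0 < x → x ≤ γ₀ → (∀ j, j ≤ k → 1 / γ₀ ^ 2 ≤ Y β γ₀ j x) → Fk x = β k (clampPrefix β γ₀ k x) := by
    intro k
    -- the survivor set as a closed subset of the normal space `]0,γ₀]`, and the trace as a continuous map on it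
    let s : Set (Set.Ioc (0 : ℝ) γ₀) := {p | ∀ j, j ≤ k → 1 / γ₀ ^ 2 ≤ Y β γ₀ j p.1}
    have hs : IsClosed s := isClosed_survivors hsc k
    have hf : Continuous fun q : s => β k (clampPrefix β γ₀ k q.1.1) :=
      (hsc k).comp_continuous (continuous_subtype_val.comp continuous_subtype_val) fun q => ⟨q.1.2.1, q.1.2.2, q.2⟩
    let f : C(s, ℝ) := ⟨fun q => β k (clampPrefix β γ₀ k q.1.1), hf⟩
    have hfq : ∀ q : s, f q = β k (clampPrefix β γ₀ k q.1.1) := fun q => rfl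
    have hft : ∀ q, f q ∈ Set.Icc b (B k) := fun q =>
      Set.mem_Icc.mpr ⟨hsl k q.1.1 q.1.2.1 q.1.2.2 q.2, hsu k q.1.1 q.1.2.1 q.1.2.2 q.2⟩
    obtain ⟨g, hgt, hgf⟩ :=
      f.exists_restrict_eq_forall_mem_of_closed hft ⟨b, Set.mem_Icc.mpr ⟨le_rfl, hbB k⟩⟩ hs
    refine ⟨fun x => if h : 0 < x ∧ x ≤ γ₀ then g ⟨x, h⟩ else b, ?_, ?_, ?_, ?_⟩
    · rw [continuousOn_iff_continuous_restrict]
      have e : (Set.Ioc (0 : ℝ) γ₀).restrict (fun x => if h : 0 < x ∧ x ≤ γ₀ then g ⟨x, h⟩ else b) = g := by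
        funext p
        have hp : 0 < (p : ℝ) ∧ (p : ℝ) ≤ γ₀ := p.2
        simp only [Set.restrict_apply, dif_pos hp, Subtype.coe_eta]
      rw [e]
      exact g.continuous
    · intro x hx hxγ
      have h : 0 < x ∧ x ≤ γ₀ := ⟨hx, hxγ⟩
      simp only [dif_pos h]
      exact (Set.mem_Icc.mp (hgt _)).1
    · intro x hx hxγ
      have h : 0 < x ∧ x ≤ γ₀ := ⟨hx, hxγ⟩
      simp only [dif_pos h]
      exact (Set.mem_Icc.mp (hgt _)).2
    · intro x hx hxγ hsurv
      have h : 0 < x ∧ x ≤ γ₀ := ⟨hx, hxγ⟩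
      simp only [dif_pos h]
      have := congrArg (fun φ : C(s, ℝ) => φ ⟨⟨x, h⟩, hsurv⟩) hgf
      simpa [hfq] using this
  choose F hF using key
  exact ⟨F, fun k => (hF k).1, fun k => (hF k).2.1, fun k => (hF k).2.2.1, fun k => (hF k).2.2.2⟩

/-- **[I] THEOREM 2's PRINTED SHAPE FROM THE SURVIVOR LETTERS (S-48).**  For a construction forward-generated by (0.20) with `β`, block size
`L > 1`: if `0 < b ≤ β′` and for every `k` the trace `x ↦ β_k(ĝ(Y_0(x)),…,ĝ(Y_k(x)))` is CONTINUOUS ON THE SURVIVOR SET `S_k` and satisfies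
`b ≤ trace ≤ β′` THERE, then `B12.Thm2Printed C L` ((0.31) with `β = b∕log L`, `β′∕log L`).  = two-sided Tietze + `FlowStepRuns.thm2Printed_of_boxBoundsH`
for `modelOf (extH F)` + `EndSurvivorExtension`'s run equivalence + the Theorem-2 transfer `EndFoliationHeadline.thm2Printed_of_runs` (g1-p3 GEN 7's,
BY NAME).  A REDUCTION to the located unprinted input `b > 0` (+ survivor continuity), NOT a proof of Theorem 2; it implies the foliation form
`EndFoliationHeadline.thm2Printed_of_foliationBounds` and the box form `FlowStepRuns.thm2Printed_of_boxBoundsH` (not re-derived here).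
[cite: Balaban1987RG1, Thm 2 (0.31) p.259] -/
theorem thm2Printed_of_survivorBounds {C : B12.Construction} {β : HBeta} (hgen : ForwardGenerated C β) {L γ₀ b β' : ℝ}
    (hL : 1 < L) (hγ₀ : 0 < γ₀) (hb : 0 < b) (hbβ' : b ≤ β')
    (hsc : ∀ k : ℕ, ContinuousOn (fun x : ℝ => β k (clampPrefix β γ₀ k x))
      {x : ℝ | 0 < x ∧ x ≤ γ₀ ∧ ∀ j, j ≤ k → 1 / γ₀ ^ 2 ≤ Y β γ₀ j x})
    (hsl : ∀ (k : ℕ) (x : ℝ), 0 < x → x ≤ γ₀ → (∀ j, j ≤ k → 1 / γ₀ ^ 2 ≤ Y β γ₀ j x) →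
      b ≤ β k (clampPrefix β γ₀ k x))
    (hsu : ∀ (k : ℕ) (x : ℝ), 0 < x → x ≤ γ₀ → (∀ j, j ≤ k → 1 / γ₀ ^ 2 ≤ Y β γ₀ j x) →
      β k (clampPrefix β γ₀ k x) ≤ β') : B12.Thm2Printed C L := by
  obtain ⟨F, hFc, hFl, hFu, hagree⟩ :=
    exists_extension_of_survivorLetters_twoSided (B := fun _ => β') (fun _ => hbβ') hsc hsl hsu
  exact thm2Printed_of_runs hγ₀ (modelOf_forwardGenerated _) (modelOf_haltsOutside _) (modelOf_curries _) hgen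
    (fun _ _ hγle _ _ hI hrg => rgEqH_of_rgEqH_extH hγle hagree hrg hI)
    (thm2Printed_of_boxBoundsH (modelOf_forwardGenerated (extH F)) hL hγ₀ hb hbβ' (betaContH_extH hFc)
      (betaLowerH_extH hFl) (betaUpperH_extH hFu))

/-! ## §2 NEGATIVE N-18: a uniform POSITIVE lower bound does not make the continuity letter spare on the Theorem-2 node (kernel §16, ported) -/

/-- THE SHIFTED STAIRCASE (Markov): `β_{k+1}(g_0, …, g_k) := φ(g_k) + c`, `φ` = `EndContLetterWitness.stair` (a TOY β; nothing of Bałaban's). [folklore] -/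
def betaJc (c : ℝ) : HBeta := fun k p => stair (p (Fin.last k)) + c

/-- Unfolding. [folklore] -/
theorem betaJc_apply (c : ℝ) (k : ℕ) (p : Fin (k + 1) → ℝ) : betaJc c k p = stair (p (Fin.last k)) + c := rfl

/-- (0.31)'s lower letter: `c ≤ β` on every box (indeed `c < β`). [folklore] -/
theorem betaLowerH_betaJc (c γ : ℝ) : BetaLowerH c γ (betaJc c) :=
  fun k v _ => by rw [betaJc_apply]; linarith [stair_pos (v (Fin.last k))]

/-- (U): `β ≤ 1 + c` on every box. [folklore] -/
theorem betaUpperH_betaJc (c γ : ℝ) : BetaUpperH (1 + c) γ (betaJc c) :=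
  fun k v _ => by rw [betaJc_apply]; linarith [stair_le_one (v (Fin.last k))]

/-- Cooperative in the earlier couplings (trivially: Markov). [folklore] -/
theorem cooperative_betaJc (c γ : ℝ) : ∀ (k : ℕ) (v v' : Fin (k + 1) → ℝ), v ∈ Box γ k → v' ∈ Box γ k → (∀ i, v i ≤ v' i) →
    v (Fin.last k) = v' (Fin.last k) → betaJc c k v ≤ betaJc c k v' := by
  intro k v v' _ _ _ hlast
  rw [betaJc_apply, betaJc_apply, hlast]

/-- Non-decreasing in the last coupling. [folklore] -/
theorem mono_last_betaJc (c γ : ℝ) : ∀ (k : ℕ) (v : Fin (k + 1) → ℝ), v ∈ Box γ k → ∀ x y : ℝ, 0 < x → x ≤ y → y ≤ γ →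
    betaJc c k (Function.update v (Fin.last k) x) ≤ betaJc c k (Function.update v (Fin.last k) y) := by
  intro k v _ x y hx hxy _
  simp only [betaJc_apply, Function.update_self]
  linarith [stair_mono hx hxy]

/-- The punctured VALUE of the shifted one-step map is `EndContLetterWitness.uJ n` shifted by `c`: no `x > 0` solves `1∕x² − (φ x + c) = u⋆_n − c`. [folklore] -/
theorem invSq_sub_stairc_ne {n : ℕ} (hn : 0 < (n : ℝ)) (c : ℝ) {x : ℝ} (hx : 0 < x) :
    1 / x ^ 2 - (stair x + c) ≠ uJ n - c := fun h =>
  invSq_sub_stair_ne_uJ hn hx (by linarith)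

/-- `u⋆_n − c > 0` for `n ≥ 2`, `c ≤ 1`. [folklore] -/
theorem uJ_sub_pos {n : ℕ} (hn : 2 ≤ (n : ℝ)) {c : ℝ} (hc1 : c ≤ 1) : 0 < uJ n - c := by
  have hn0 : (0 : ℝ) < n := by linarith
  have h := gap_below hn0
  have h1 : 1 / (n : ℝ) ≤ 1 := by rw [div_le_one hn0]; linarith
  nlinarith

/-- The punctured COUPLING `g⋆_{n,c} := (u⋆_n − c)^{−1∕2}`. [folklore] -/
def gJc (c : ℝ) (n : ℕ) : ℝ := solveCoupling (uJ n - c)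

/-- `g⋆_{n,c} > 0`. [folklore] -/
theorem gJc_pos {n : ℕ} (hn : 2 ≤ (n : ℝ)) {c : ℝ} (hc1 : c ≤ 1) : 0 < gJc c n := solveCoupling_pos (uJ_sub_pos hn hc1)

/-- `1∕(g⋆_{n,c})² = u⋆_n − c`. [folklore] -/
theorem inv_sq_gJc {n : ℕ} (hn : 2 ≤ (n : ℝ)) {c : ℝ} (hc1 : c ≤ 1) : 1 / (gJc c n) ^ 2 = uJ n - c :=
  inv_sq_solveCoupling (uJ_sub_pos hn hc1)

/-- `g⋆_{n,c} ≤ g` as soon as `1∕g² ≤ u⋆_n − c`. [folklore] -/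
theorem gJc_le {n : ℕ} (hn : 2 ≤ (n : ℝ)) {c : ℝ} (hc1 : c ≤ 1) {g : ℝ} (hg : 0 < g) (h : 1 / g ^ 2 ≤ uJ n - c) :
    gJc c n ≤ g := by
  have h1 : 1 / g ^ 2 ≤ 1 / (gJc c n) ^ 2 := by rw [inv_sq_gJc hn hc1]; exact h
  have h2 : (gJc c n) ^ 2 ≤ g ^ 2 := (one_div_le_one_div (pow_pos hg 2) (pow_pos (gJc_pos hn hc1) 2)).mp h1
  nlinarith [gJc_pos hn hc1, hg, h2]

/-- **NO END FOR THE SHIFTED STAIRCASE (N-18)**: for `c ≤ 1` the canonical construction of `betaJc c` has NO `EndpointExistence` — every window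
`]0, g⋆]` contains a punctured coupling `g⋆_{n,c}` (`n ≥ 2`), which is `g_1` of NO run (`K = 1`, any torus exponent). [folklore] -/
theorem not_endpointExistence_betaJc {c : ℝ} (hc1 : c ≤ 1) : ¬ EndpointExistence (modelOf (betaJc c)) := by
  intro hE
  obtain ⟨γ₂, hγ₂, h⟩ := hE 0
  obtain ⟨gstar, hgstar, h⟩ := h γ₂ hγ₂ le_rfl
  -- the jump index: `n - 2 ≥ 1∕g⋆`, `n ≥ 2`
  obtain ⟨n, hn2, hceil⟩ : ∃ n : ℕ, (2 : ℝ) ≤ n ∧ 1 / gstar ≤ (n : ℝ) - 2 :=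
    ⟨⌈1 / gstar⌉₊ + 2, by push_cast; linarith [Nat.cast_nonneg (α := ℝ) ⌈1 / gstar⌉₊],
      by push_cast; linarith [Nat.le_ceil (1 / gstar)]⟩
  have hn0 : (0 : ℝ) < n := by linarith
  -- the punctured coupling lies in the window: `1∕g⋆² ≤ (n−2)² ≤ n² − 1∕n − 1 ≤ u⋆_n − c`
  have hwin : 1 / gstar ^ 2 ≤ uJ n - c := by
    have h0 : 0 ≤ 1 / gstar := by positivity
    have h1 : 1 / gstar ^ 2 = (1 / gstar) ^ 2 := by rw [div_pow, one_pow]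
    have h2 : (1 / gstar) ^ 2 ≤ ((n : ℝ) - 2) ^ 2 := by gcongr
    have h3 := gap_below hn0
    have h4 : 1 / (n : ℝ) ≤ 1 := by rw [div_le_one hn0]; linarith
    nlinarith
  obtain ⟨g0, hI, hK⟩ := h (gJc c n) (gJc_pos hn2 hc1) (gJc_le hn2 hc1 hgstar hwin) 1
  -- read the run: `g_0 = g0 > 0`, `g_1 = solveCoupling (1∕g0² − φ g0 − c) = g⋆_{n,c}`
  have hP0 : 0 < genSeq (betaJc c) g0 0 ∧ genSeq (betaJc c) g0 0 ≤ γ₂ := hI 0 (Nat.zero_le _)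
  have hK' : genSeq (betaJc c) g0 1 = gJc c n := hK
  rw [genSeq_zero] at hP0
  have hβ0 : betaJc c 0 (prefixOf (genSeq (betaJc c) g0) 0) = stair g0 + c := by
    simp only [betaJc_apply, prefixOf_apply, Fin.val_last, genSeq_zero]
  rw [genSeq_succ, genSeq_zero, hβ0] at hK'
  have hy : 0 < 1 / g0 ^ 2 - (stair g0 + c) := by
    by_contra hneg
    have h1 := solveCoupling_nonpos (not_lt.mp hneg)
    linarith [gJc_pos hn2 hc1]
  have hval : 1 / g0 ^ 2 - (stair g0 + c) = uJ n - c := by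
    have h1 := inv_sq_solveCoupling hy
    rw [hK', inv_sq_gJc hn2 hc1] at h1
    exact h1.symm
  exact invSq_sub_stairc_ne hn0 c hP0.1 hval

/-- … hence NO printed Theorem-2 shape for the shifted staircase, at any block size. [folklore] -/
theorem not_thm2Printed_betaJc {c : ℝ} (hc1 : c ≤ 1) (L : ℝ) : ¬ B12.Thm2Printed (modelOf (betaJc c)) L :=
  fun h2 => not_endpointExistence_betaJc hc1 (endpointExistence_of_thm2Printed h2)

/-- **N-18 (a): `FlowStepRuns.thm2Printed_of_boxBoundsH` is FALSE with its continuity binder `hcont` deleted** — even with a uniform POSITIVE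
lower bound (witness: the shifted staircase `c = 1∕2`, `1∕2 ≤ β ≤ 3∕2` on every box, `γ₀ = 1`, `L = 2`). [folklore] -/
theorem thm2BoxBounds_false_without_hcont :
    ¬ ∀ (β : HBeta) (L γ₀ b β' : ℝ), 1 < L → 0 < γ₀ → 0 < b → b ≤ β' →
      BetaLowerH b γ₀ β → BetaUpperH β' γ₀ β → B12.Thm2Printed (modelOf β) L := by
  intro h
  exact not_thm2Printed_betaJc (c := 1 / 2) (by norm_num) 2
    (h (betaJc (1 / 2)) 2 1 (1 / 2) (1 + 1 / 2) (by norm_num) one_pos (by norm_num) (by norm_num)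
      (betaLowerH_betaJc (1 / 2) 1) (betaUpperH_betaJc (1 / 2) 1))

/-- **N-18 (b): a fortiori the survivor form `thm2Printed_of_survivorBounds` is FALSE with its continuity binder `hsc` deleted.** [folklore] -/
theorem thm2SurvivorBounds_false_without_hsc :
    ¬ ∀ (β : HBeta) (L γ₀ b β' : ℝ), 1 < L → 0 < γ₀ → 0 < b → b ≤ β' →
      (∀ (k : ℕ) (x : ℝ), 0 < x → x ≤ γ₀ → (∀ j, j ≤ k → 1 / γ₀ ^ 2 ≤ Y β γ₀ j x) → b ≤ β k (clampPrefix β γ₀ k x)) →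
      (∀ (k : ℕ) (x : ℝ), 0 < x → x ≤ γ₀ → (∀ j, j ≤ k → 1 / γ₀ ^ 2 ≤ Y β γ₀ j x) → β k (clampPrefix β γ₀ k x) ≤ β') →
      B12.Thm2Printed (modelOf β) L := by
  intro h
  exact thm2BoxBounds_false_without_hcont fun β L γ₀ b β' hL hγ₀ hb hbβ' hlo hup =>
    h β L γ₀ b β' hL hγ₀ hb hbβ' (fun k x _ _ _ => hlo k _ (clampPrefix_mem_box hγ₀ k x))
      (fun k x _ _ _ => hup k _ (clampPrefix_mem_box hγ₀ k x))

/-- **THE THEOREM-2 SURVIVOR CENSUS (R-39)**: (i) survivor continuity + two-sided survivor bounds `0 < b ≤ trace ≤ β′` ⟹ Theorem 2's printed shape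
for every forward-generated construction; (ii) without the continuity letter this FAILS already for box bounds (N-18); (iii) the printed shape
contains the END (so N-15 of `EndContLetterWitness` and the survivor census of `EndSurvivorCensus` apply to it verbatim). [folklore] -/
theorem thm2_survivor_census :
    (∀ (C : B12.Construction) (β : HBeta) (L γ₀ b β' : ℝ), ForwardGenerated C β → 1 < L → 0 < γ₀ → 0 < b → b ≤ β' →
      (∀ k : ℕ, ContinuousOn (fun x : ℝ => β k (clampPrefix β γ₀ k x))
        {x : ℝ | 0 < x ∧ x ≤ γ₀ ∧ ∀ j, j ≤ k → 1 / γ₀ ^ 2 ≤ Y β γ₀ j x}) →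
      (∀ (k : ℕ) (x : ℝ), 0 < x → x ≤ γ₀ → (∀ j, j ≤ k → 1 / γ₀ ^ 2 ≤ Y β γ₀ j x) → b ≤ β k (clampPrefix β γ₀ k x)) →
      (∀ (k : ℕ) (x : ℝ), 0 < x → x ≤ γ₀ → (∀ j, j ≤ k → 1 / γ₀ ^ 2 ≤ Y β γ₀ j x) → β k (clampPrefix β γ₀ k x) ≤ β') →
      B12.Thm2Printed C L) ∧
    (¬ ∀ (β : HBeta) (L γ₀ b β' : ℝ), 1 < L → 0 < γ₀ → 0 < b → b ≤ β' →
      BetaLowerH b γ₀ β → BetaUpperH β' γ₀ β → B12.Thm2Printed (modelOf β) L) ∧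
    (∀ (C : B12.Construction) (L : ℝ), B12.Thm2Printed C L → EndpointExistence C) :=
  ⟨fun _ _ _ _ _ _ hgen hL hγ₀ hb hbβ' hsc hsl hsu => thm2Printed_of_survivorBounds hgen hL hγ₀ hb hbβ' hsc hsl hsu,
    thm2BoxBounds_false_without_hcont, fun _ _ h2 => endpointExistence_of_thm2Printed h2⟩

/-! ## §3 [I] Thm 2's printed shape for Bałaban's datum from the survivor letters (kernel `Datum16`, ported) -/

section Datum

variable {F : T4Family} {G : Type u} [GaugeGroup G] [MeasurableSpace G] [HaarData G]

/-- **[I] THM 2's PRINTED SHAPE FOR BAŁABAN's DATUM FROM THE SURVIVOR LETTERS**: `0 < b ≤ β′`, and for every `k` the trace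
`x ↦ D.βfun k (clampPrefix D.βfun γ₀ k x)` continuous ON `S_k` with `b ≤ · ≤ β′` ON `S_k` ⟹ `B12.Thm2Printed D.C.toB12 L` for every `L > 1`
(forward generation is the FIELD `D.fwd`).  Versus `EndRunwiseHeadline.thm2Printed_of_coneBounds_datum` (g1-p3 GEN 6: bounds on the running cone,
continuity on the boxes) and `EndFoliationHeadline.thm2Printed_of_foliationBounds_datum` (GEN 7: both on the one-parameter family): here both sit on
the survivor sets only. [cite: Balaban1987RG1, Thm 2 (0.31) p.259] -/
theorem thm2Printed_of_survivorBounds_datum (D : FiniteEpsData F G) {L γ₀ b β' : ℝ} (hL : 1 < L) (hγ₀ : 0 < γ₀)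
    (hb : 0 < b) (hbβ' : b ≤ β')
    (hsc : ∀ k : ℕ, ContinuousOn (fun x : ℝ => D.βfun k (clampPrefix D.βfun γ₀ k x))
      {x : ℝ | 0 < x ∧ x ≤ γ₀ ∧ ∀ j, j ≤ k → 1 / γ₀ ^ 2 ≤ Y D.βfun γ₀ j x})
    (hsl : ∀ (k : ℕ) (x : ℝ), 0 < x → x ≤ γ₀ → (∀ j, j ≤ k → 1 / γ₀ ^ 2 ≤ Y D.βfun γ₀ j x) →
      b ≤ D.βfun k (clampPrefix D.βfun γ₀ k x))
    (hsu : ∀ (k : ℕ) (x : ℝ), 0 < x → x ≤ γ₀ → (∀ j, j ≤ k → 1 / γ₀ ^ 2 ≤ Y D.βfun γ₀ j x) →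
      D.βfun k (clampPrefix D.βfun γ₀ k x) ≤ β') :
    B12.Thm2Printed D.C.toB12 L :=
  thm2Printed_of_survivorBounds D.fwd hL hγ₀ hb hbβ' hsc hsl hsu

end Datum

end

end Summit.QuantumFields.BalabanUV.Gaps.EndSurvivorThm2
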